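import Literature.Computability.MetaComplexity.GapMINKTSearchProofs
import HarnessLib

/-!
# `MINKT[r] ∈ NP`: Hirahara's Fact 4.15, `NP` half (proofs)

Second sibling proof file of `GapMINKTDenseRandom.lean` (D-0014; the first,
`GapMINKTDenseRandomProofs.lean`, discharges Lemma 4.17). It DISCHARGES the named fact
`Literature.Computability.MetaComplexity.Hirahara2018_MINKTr_mem_NP` (Hirahara, FOCS 2018 / ECCC
TR18-138 rev. 1, Def. 4.14 and Fact 4.15, p. 20: *"For a function `r : ℕ → ℕ`, define
`MINKT[r] := {(x, 1^t) | K_t(x) < r(|x|)}`. … It is easy to see that `MINKT[r] ∈ NP`, and thus: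
Fact 4.15. `(MINKT[r], 𝒟^KT) ∈ DistNP` if `r : ℕ → ℕ` is efficiently computable"*; the one-line
argument is the one printed for `MINKT` after Def. 3.4, p. 12: *"by guessing a certificate `d` of
length at most `s`, and checking whether `U(d)` outputs `x` within `t` steps"*, here with the strict
bound `|d| < r(|x|)`).

In the tree `NP = polyExists P` (`Nondeterministic.lean`, Arora–Barak Def. 2.1), so the proof is a
genuine polynomial-time `FinTM2` verifier, assembled — as for Fact 3.8 in
`GapMINKTSearchProofs.lean` — in the "algebra of `FP` bricks" style, with no new Turing machine
(namespace `MINKTrVerifier`: four languages and their membership lemmas). The verifier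
`verLang U r` reads `⟨w, d⟩` (instance `w`, certificate `d`) and accepts iff

* **WF** (`wfLang`) — `w` is a well-formed instance `⟨x, 1^t⟩ = paramEnc (x, t)`: the equality test
  `w = unaryArgFn w` (`unaryArgFn w = ⟨(boolUnpair w).1, 1^{|(boolUnpair w).2|}⟩`,
  `PairPlumbing.lean`; equality tests of `FP` maps are in `P`, `setOf_apply_eq_apply_mem_P`).
  This conjunct is what makes the verifier decide the LANGUAGE `U.MINKTr r` (which contains
  well-formed codes only) rather than a promise problem: malformed `w` have no certificate;
* **LEN** (`lenLang r`) — `|d| < r(|x|)`: the length test `LenLe X` (`LengthCompare.lean`) on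
  `⟨1^{r(|x|)}, 1d⟩` (`|1d| ≤ r(|x|)`), the unary value `1^{r(|x|)}` being the machine of `r` after
  the length map `onesFn` (`lenLang_mem_P`);
* **PRINT** (`printLang U`) — `U(d)` outputs `x` within `t = |u|` steps, `u` the second field of `w`:
  the equality test `encO (U.run d |u|) = 1x` with the universal machine as the total string
  function `GapMINKTDecision.runU` of `GapMINKTSearchProofs.lean` (the field
  `UniversalMachine.polyTime`, budget in unary).

Completeness: `K^t(x) < r(|x|)` gives a program `d` with `U.run d t = some x` and `|d| < r(|x|)`
(`exists_run_eq_of_ktAt_lt`); the certificate bound is `|d| < r(|x|) ≤ s(|x|) ≤ s(|w|)` for a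
polynomial bound `s` of `r` (`exists_poly_le_of_polyTimeComputable_unary`: the machine of `r` pushes
boundedly many symbols per step) — this is where "efficiently computable"
(`PolyTimeComputable unaryEncodeNat unaryEncodeNat r`, forcing `r(n) ≤ poly(n)`) enters. Soundness: WF rebuilds `w = paramEnc (x, t)`, PRINT and LEN give
`K^t(x) ≤ |d| < r(|x|)` (`ktAt_le_length`).

Main result: `Hirahara2018_MINKTr_mem_NP_holds`. The `DistNP` half of Fact 4.15 is deliberately not
here (`𝒟^KT ∉ PSamp` verbatim under the tree's exact samplers; module docstring of
`GapMINKTDenseRandom.lean`, "Samplability").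

## References

* S. Hirahara, *Non-black-box worst-case to average-case reductions within NP*, FOCS 2018,
  247–258, doi:10.1109/focs.2018.00032; full version ECCC TR18-138 rev. 1 (2019): Def. 3.4 (with
  the remark "`MINKT ∈ NP`", p. 12), Def. 4.14 and Fact 4.15 (p. 20) [Hirahara2018]. (Numbered in
  the full version only; the FOCS proceedings version has the `MINKT ∈ NP` remark after Def. II.4.)
* S. Arora, B. Barak, *Computational Complexity: A Modern Approach*, CUP 2009, Def. 2.1 (`NP` via
  certificates), §1.3 (closure of polynomial time under composition) [AroraBarak2009].
-/

namespace Literature.Computability.MetaComplexity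

open _root_.Computability Complexity Polynomial

namespace MINKTrVerifier

/-! ### Efficiently computable thresholds are polynomially bounded -/

/-- An efficiently computable `r : ℕ → ℕ` (unary input and output) is polynomially bounded,
`r(n) ≤ n + D · p(n)` for the time polynomial `p` and push bound `D` of its machine: a `FinTM2`
machine pushes at most `D` symbols per step (`OutputsWithin.length_le`). This is where the
hypothesis "efficiently computable" of Fact 4.15 enters: it bounds the certificate length.
[cite: AroraBarak2009, §1.3] -/
theorem exists_poly_le_of_polyTimeComputable_unary {r : ℕ → ℕ}
    (hr : PolyTimeComputable unaryEncodeNat unaryEncodeNat r) :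
    ∃ s : Polynomial ℕ, ∀ n : ℕ, r n ≤ s.eval n := by
  obtain ⟨p, M, hM⟩ := hr
  refine ⟨X + C (TM2Comp.machinePushBound M.tm) * p, fun n => ?_⟩
  have h := (hM n).length_le
  simpa [GapMINKTDecision.length_unaryEncodeNat] using h

/-! ### The three tests and the verifier

On the verifier's input `z = ⟨w, d⟩ = ⟨⟨x, u⟩, d⟩`: `Brick.fstF z = w`, `Brick.sndF z = d`,
`GapMINKTDecision.X0 z = x = (boolUnpair w).1` (`X0 = fstF ∘ fstF`, `GapMINKTSearchProofs.lean`),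
`(Brick.sndF ∘ Brick.fstF) z = u = (boolUnpair w).2`. -/

variable (U : UniversalMachine) (r : ℕ → ℕ)

/-- **WF**: the instance `w` is a well-formed code `⟨x, 1^t⟩ = paramEnc (x, t)`, as the equality test
`w = unaryArgFn w` (`unaryArgFn w = ⟨(boolUnpair w).1, 1^{|(boolUnpair w).2|}⟩`). [folklore] -/
def wfLang : Language Bool := {z | Brick.fstF z = (unaryArgFn ∘ Brick.fstF) z}

/-- **LEN**: `|d| < r(|x|)`, as the length test `|1d| ≤ r(|x|)` (`LenLe X`) on `⟨1^{r(|x|)}, 1d⟩`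
("a certificate `d` of length" `< r(|x|)`). [cite: Hirahara2018, Def. 4.14 and Fact 4.15] -/
def lenLang : Language Bool :=
  fanoutFn ((fun x : List Bool => unaryEncodeNat (r x.length)) ∘ GapMINKTDecision.X0)
    (List.cons true ∘ Brick.sndF) ⁻¹' LenLe X

/-- **PRINT**: "`U(d)` outputs `x` within `t` steps", `t = |u|`, as the equality test
`encO (U.run d |u|) = 1x` (`GapMINKTDecision.runU`, the universal machine as a total string
function). [cite: Hirahara2018, Def. 3.4 (remark) and Fact 4.15] -/
def printLang : Language Bool :=
  {z | (GapMINKTDecision.runU U ∘ fanoutFn Brick.sndF (Brick.sndF ∘ Brick.fstF)) z =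
    (List.cons true ∘ GapMINKTDecision.X0) z}

/-- **The verifier of `MINKT[r]`**: WF, LEN and PRINT ("guess a certificate `d` … and check whether
`U(d)` outputs `x` within `t` steps"). [cite: Hirahara2018, Fact 4.15] -/
def verLang : Language Bool := wfLang ⊓ (lenLang r ⊓ printLang U)

/-- `wfLang ∈ P` (an equality test of `FP` maps, `unaryArgFn_mem_FP`). [cite: AroraBarak2009, §1.3] -/
theorem wfLang_mem_P : wfLang ∈ Classes.P :=
  setOf_apply_eq_apply_mem_P Brick.fstF_mem_FP (comp_mem_FP unaryArgFn_mem_FP Brick.fstF_mem_FP)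

variable {r} in
/-- `lenLang r ∈ P` for an efficiently computable `r`: the unary value `1^{r(|x|)}` is the length
map `onesFn` followed by the machine of `r` (`PolyTimeComputable.comp_holds`), and LEN is an
`FP`-preimage of the length test `LenLe X`. [cite: AroraBarak2009, §1.3] -/
theorem lenLang_mem_P (hr : PolyTimeComputable unaryEncodeNat unaryEncodeNat r) :
    lenLang r ∈ Classes.P := by
  -- the length map `onesFn : x ↦ 1^{|x|}` presented through the input encoder of `r`'s machine
  have hlen : PolyTimeComputable (id : List Bool → List Bool) unaryEncodeNat
      (List.length : List Bool → ℕ) := by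
    obtain ⟨p, M, hM⟩ := onesFn_mem_FP
    exact ⟨p, M, fun w => hM w⟩
  -- `x ↦ 1^{r(|x|)}` is in `FP` (as `QuantumComplexity.unaryLenFn_mem_FP`, not importable here)
  have hrF : (fun x : List Bool => unaryEncodeNat (r x.length)) ∈ FP := by
    obtain ⟨p, M, hM⟩ := PolyTimeComputable.comp_holds hr hlen
    exact ⟨p, M, fun w => hM w⟩
  exact preimage_mem_P (LenLe_mem_P X)
    (fanoutFn_mem_FP (comp_mem_FP hrF GapMINKTDecision.X0_mem_FP)
      (comp_mem_FP (cons_mem_FP true) Brick.sndF_mem_FP))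

/-- `printLang U ∈ P` (an equality test of `FP` maps; the universal machine is polynomial time,
`GapMINKTDecision.runU_mem_FP`). [cite: AroraBarak2009, §1.3] -/
theorem printLang_mem_P : printLang U ∈ Classes.P :=
  setOf_apply_eq_apply_mem_P
    (comp_mem_FP (GapMINKTDecision.runU_mem_FP U)
      (fanoutFn_mem_FP Brick.sndF_mem_FP (comp_mem_FP Brick.sndF_mem_FP Brick.fstF_mem_FP)))
    (comp_mem_FP (cons_mem_FP true) GapMINKTDecision.X0_mem_FP)

variable {r} in
/-- **The verifier is polynomial time**: `verLang U r ∈ P` (`P` is closed under intersection).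
[cite: Hirahara2018, Fact 4.15] -/
theorem verLang_mem_P (hr : PolyTimeComputable unaryEncodeNat unaryEncodeNat r) :
    verLang U r ∈ Classes.P :=
  inter_mem_P wfLang_mem_P (inter_mem_P (lenLang_mem_P hr) (printLang_mem_P U))

/-! ### Semantics of the tests on an arbitrary pair `⟨w, d⟩` -/

section Semantics

variable (w d : List Bool)

/-- WF holds iff `w` is the code of `((boolUnpair w).1, |(boolUnpair w).2|)`. [folklore] -/
theorem boolPair_mem_wfLang_iff :
    boolPair w d ∈ wfLang ↔ w = paramEnc ((boolUnpair w).1, (boolUnpair w).2.length) := by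
  change Brick.fstF (boolPair w d) = (unaryArgFn ∘ Brick.fstF) (boolPair w d) ↔ _
  rw [Function.comp_apply, Brick.fstF_boolPair, unaryArgFn_apply]
  rfl

/-- Membership in LEN, unfolded (definitional). [folklore] -/
theorem mem_lenLang_iff (z : List Bool) :
    z ∈ lenLang r ↔
      fanoutFn ((fun x : List Bool => unaryEncodeNat (r x.length)) ∘ GapMINKTDecision.X0)
        (List.cons true ∘ Brick.sndF) z ∈ LenLe X :=
  Iff.rfl

/-- LEN holds iff `|d| < r(|(boolUnpair w).1|)`. [folklore] -/
theorem boolPair_mem_lenLang_iff :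
    boolPair w d ∈ lenLang r ↔ d.length < r (boolUnpair w).1.length := by
  rw [mem_lenLang_iff, fanoutFn_apply, boolPair_mem_LenLe, eval_X]
  simp only [Function.comp_apply, GapMINKTDecision.X0, Brick.fstF_boolPair, Brick.sndF_boolPair,
    List.length_cons, GapMINKTDecision.length_unaryEncodeNat, Nat.add_one_le_iff]
  rfl

/-- PRINT holds iff `U.run d |(boolUnpair w).2| = some (boolUnpair w).1`. [folklore] -/
theorem boolPair_mem_printLang_iff :
    boolPair w d ∈ printLang U ↔ U.run d (boolUnpair w).2.length = some (boolUnpair w).1 := by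
  change (GapMINKTDecision.runU U ∘ fanoutFn Brick.sndF (Brick.sndF ∘ Brick.fstF)) (boolPair w d) =
    (List.cons true ∘ GapMINKTDecision.X0) (boolPair w d) ↔ _
  simp only [Function.comp_apply, fanoutFn_apply, GapMINKTDecision.X0, Brick.fstF_boolPair,
    Brick.sndF_boolPair, GapMINKTDecision.runU_boolPair, GapMINKTDecision.encO_eq_cons_iff]
  rfl

/-- **Membership in the verifier language**: WF, LEN and PRINT, unfolded. [folklore] -/
theorem boolPair_mem_verLang_iff :
    boolPair w d ∈ verLang U r ↔
      w = paramEnc ((boolUnpair w).1, (boolUnpair w).2.length) ∧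
        d.length < r (boolUnpair w).1.length ∧
        U.run d (boolUnpair w).2.length = some (boolUnpair w).1 := by
  change boolPair w d ∈ wfLang ∧ (boolPair w d ∈ lenLang r ∧ boolPair w d ∈ printLang U) ↔ _
  rw [boolPair_mem_wfLang_iff, boolPair_mem_lenLang_iff, boolPair_mem_printLang_iff]

end Semantics

/-- On a well-formed instance `⟨x, 1^t⟩` the verifier accepts `d` iff `|d| < r(|x|)` and `U(d)`
outputs `x` within `t` steps. [cite: Hirahara2018, Fact 4.15] -/
theorem paramEnc_boolPair_mem_verLang_iff (x d : List Bool) (t : ℕ) :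
    boolPair (paramEnc (x, t)) d ∈ verLang U r ↔ d.length < r x.length ∧ U.run d t = some x := by
  rw [boolPair_mem_verLang_iff]
  simp [paramEnc, GapMINKTDecision.length_unaryEncodeNat]

end MINKTrVerifier

open MINKTrVerifier

/-! ### The discharge of Fact 4.15 (`NP` half) -/

/-- **Hirahara 2018, Fact 4.15 (`NP` half), discharged** (`Hirahara2018_MINKTr_mem_NP`):
`MINKT[r] ∈ NP` for every clocked universal machine `U` and every efficiently computable
`r : ℕ → ℕ` (unary input and output). The `P`-verifier is `MINKTrVerifier.verLang U r`
(well-formedness of the instance, `|d| < r(|x|)`, and `U(d) = x` within `t` steps); the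
certificate-length polynomial is a polynomial bound `s` of `r`
(`|d| < r(|x|) ≤ s(|x|) ≤ s(|⟨x, 1^t⟩|)`, `exists_poly_le_of_polyTimeComputable_unary`); completeness is `exists_run_eq_of_ktAt_lt`, soundness
`ktAt_le_length`. [cite: Hirahara2018, Fact 4.15] -/
theorem Hirahara2018_MINKTr_mem_NP_holds : Hirahara2018_MINKTr_mem_NP := by
  intro U r hr
  obtain ⟨s, hs⟩ := exists_poly_le_of_polyTimeComputable_unary hr
  refine ⟨verLang U r, verLang_mem_P U hr, s, fun w => ⟨?_, ?_⟩⟩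
  · rintro ⟨x, t, rfl, hlt⟩
    obtain ⟨d, hrun, hlen⟩ := U.exists_run_eq_of_ktAt_lt hlt
    have hlen' : d.length < r x.length := by exact_mod_cast hlen
    refine ⟨d, ?_, (paramEnc_boolPair_mem_verLang_iff U r x d t).2 ⟨hlen', hrun⟩⟩
    calc d.length ≤ r x.length := hlen'.le
      _ ≤ s.eval x.length := hs x.length
      _ ≤ s.eval (paramEnc (x, t)).length :=
        TM2Iter.eval_mono s (by simp only [paramEnc, length_boolPair]; omega)
  · rintro ⟨d, -, hd⟩
    obtain ⟨hw, hlen, hrun⟩ := (boolPair_mem_verLang_iff U r w d).1 hd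
    exact ⟨(boolUnpair w).1, (boolUnpair w).2.length, hw,
      (U.ktAt_le_length hrun).trans_lt (by exact_mod_cast hlen)⟩

end Literature.Computability.MetaComplexity
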